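import Summits.BirchSwinnertonDyer.Rank1Residual.Additive.X4ThreeResCertKernel
import Summits.BirchSwinnertonDyer.Rank1Residual.Supersingular.DescentLowerBound
import HarnessLib

/-!
# X4 ∧ `r_an = 0`, every odd `p`: the LOWER residue closes PER PAIR by ONE descent certificate —
# covered locus + Cassels–Tate + (`p^{2k-1} ∣ #Ш` | `Sel^(p)(E/ℚ) ≠ 0`) ⟹ `BSD(E,p)`
# (cell `b2b-bsdres`, seat additive-p4 gen 15, line V25b; companion of `Additive/X4RankZeroCoveredLocus.lean`)

HONEST FRAMING (cell `b2b-bsdres`, run/shared/lean/b2b/bsd-rank1-residual/, verbatim in every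
file): the goal of the cell is to DELETE the COMBINATION-SHAPED residual classes of the
Birch–Swinnerton-Dyer formula for ALL analytic-rank `≤ 1` elliptic curves over `ℚ` — "full BSD
formula for every rank `≤ 1` curve in class `C`" assembled STRICTLY from published theorems — so
that the rank-`≤ 1` remainder becomes exactly the CONSTRUCTION-SHAPED classes, which are TYPED
(missing-input `Prop`s), NOT attempted. This is not "finishing BSD". Sub-cell additive-p4 (X3♯/X4♯
direct): research route on the CONSTRUCTION-SHAPED class X4; PER-PAIR certificate consumers, not a
class theorem; the label X4 is UNCHANGED; nothing is booked by this file. Theorems only (no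
definition, no named fact minted; every published input is an explicit named-fact hypothesis).

## What this file proves

Gen 14's end-state theorem `x4SharpUnitFree_iff_lower_and_residues_sharp`
(`Additive/X4SharpUnitFreeResidueSharp.lean`) leaves, on the covered locus of X4 ∧ `r_an = 0`
[`ord_p j < 0` ∨ (tower ∧ `ord_p ∏ c_ℓ = ord_p c_p` ∧ Manin datum)], exactly ONE missing input: the
LOWER half `ord_p #Ш_an ≤ ord_p #Ш` on the rows with `p ∣ #Ш_an` (census V22–V24: 85 ‖ 25 window
rows at `p ∈ {3, 5}`, ≈ 8 550 sweep rows; no printed main-conjecture EQUALITY reaches an additive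
`p` — REPAIR-CENSUS gen 11/14). This file records, in the vocabulary of the chain of record, that the
LOWER residue is CERTIFICATE-SHAPED per pair:

* §1 `X4RankZero.bsdp_of_facts_of_casselsTate_of_pow_dvd` — covered locus ∧ `#Ш_an = q`,
  `ord_p q ≤ 2k` ∧ the certificate `p^{2k−1} ∣ #Ш(E)` ⟹ `BSD(E,p)`: Cassels–Tate squareness
  (`hCT`, bsd.S18) upgrades the certificate to `p^{2k} ∣ #Ш` (tree theorem
  `Typed.missingLowerBoundAt_of_casselsTate_of_pow_dvd`), i.e. the LOWER half, and
  `X4RankZero.bsdp_of_facts_of_lower` concludes.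
* §2 `X4RankZero.bsdp_of_facts_of_casselsTate_of_selmerGroup_ne_bot` — on the `ord_p #Ш_an ≤ 2`
  rows (84 of the 85 window LOWER rows have `#Ш_an = p²`; the 85th, `19215t1` @ `3`, has
  `#Ш_an = 3⁴` and needs §1 with `k = 2`) the certificate is the NATIVE `p`-descent line
  `Sel^(p)(E/ℚ) ≠ 0`: rank `0` (GZK) and `E(ℚ)[p] = 0` (`E[p]` irreducible on X4) make every
  non-zero Selmer class a non-zero element of `Ш[p]` (x10b's class-free
  `Supersingular.missingLowerBoundAt_of_casselsTate_of_selmerGroup_ne_bot`, PROVED fundamental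
  sequence), then §1 with `k = 1`.
* §3 the census shapes: `…_of_five_le` (`p ≥ 5`: certificate part `p ∤ ∏ c_ℓ` ∧ Manin datum, tower
  and local term automatic) and, at `p = 3`, `X4RankZero.bsdp_three_of_towerSurj_of_optimal_of_selmerGroup_ne_bot`
  (gen 15's kernel-certificate form: `Addv`, surj(3), tower record, `3 ∤ ∏ c_ℓ`, optimal datum —
  `Additive/X4ThreeResCertKernel.lean`) and `X4RankZero.bsdp_three_potMult_of_selmerGroup_ne_bot`
  (the (M) rows `ord₃ j < 0`: no tower / Tamagawa / Manin binder at all).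

So every LOWER row of the census closes by published theorems + ONE line `Sel^(p)(E/ℚ) ≠ 0` from a
`p`-descent (two engines, the lane's standard; at `p = 3` with surjective `ρ̄_{E,3}` a
Schaefer–Stoll descent in the degree-`8` algebra — the sha-2 / x11c seats' instruments), exactly as
the TAM-DEFECT₂ rows close by the line `Sel^(p)(E/ℚ) = 0` (`Typed.bsdp_of_card_selmerGroup_eq_pow_analyticRank`).
Nothing is certified HERE; X4 stays CONSTRUCTION-SHAPED; nothing booked.

References: Kato 2004 [Kato2004Asterisque] Thm. 14.5 (3), Prop. 14.16 (2); Delbourgo 1998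
[Delbourgo1998] Prop. 4; Cassels 1962 / Silverman *AEC* [SilvermanAEC2009] Thm. X.4.14; Schaefer–Stoll
2004; Miller 2011 [Miller2011LMS] Def. 1.1; Agashe–Ribet–Stein 2006 [AgasheRibetStein2006] Thm. 2.6.
-/

noncomputable section

open scoped Classical

open WeierstrassCurve Literature.NumberTheory.EllipticCurves
  Literature.NumberTheory.EllipticCurves.ModularForms
  Literature.NumberTheory.EllipticCurves.Rank1Residual
  Literature.NumberTheory.EllipticCurves.Rank1Residual.Typed
  Literature.NumberTheory.EllipticCurves.AgasheRibetStein2006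

namespace Summit.BirchSwinnertonDyer.Rank1Residual.Additive

variable (W : WeierstrassCurve ℚ) [W.IsElliptic] [W.IsGloballyMinimal] (p : ℕ) [hp : Fact p.Prime]

/-! ### §1 Covered locus + Cassels–Tate + `p^{2k-1} ∣ #Ш` ⟹ `BSD(E,p)` -/

/-- **The LOWER residue of X4 ∧ `r_an = 0` closes per pair by a divisibility certificate.** On the
covered locus [`ord_p j < 0` ∨ (tower ∧ `ord_p ∏ c_ℓ = ord_p c_p` ∧ Manin datum)] of X4 ∧
`r_an = 0` ∧ surj(p), with `#Ш_an = q`, `ord_p q ≤ 2k` and the certificate `p^{2k−1} ∣ #Ш(E/ℚ)`: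
`BSD(E,p)` — Cassels–Tate squareness (`hCT`) gives the LOWER half
(`Typed.missingLowerBoundAt_of_casselsTate_of_pow_dvd`; `Ш` finite by GZK), the five named facts
give the UPPER half (`X4RankZero.bsdp_of_facts_of_lower`).
[cite: Kato2004Asterisque, Thm. 14.5 (3) (p. 236)] [cite: Delbourgo1998, Prop. 4 (p. 144)]
[cite: SilvermanAEC2009, Thm. X.4.14] [cite: Miller2011LMS, §1 and Def. 1.1] -/
theorem X4RankZero.bsdp_of_facts_of_casselsTate_of_pow_dvd
    (hKatoS : Kato2004.rankZero_padicValNat_sha_le_sub_localTamagawa_of_additive_potGood_of_imageContainsSL2)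
    (hDel : Delbourgo1998.prop4_rankZero_pow_dvd_constantCoeff)
    (hGZK : rank_eq_analyticRank_of_analyticRank_le_one) (hmod : hasEntireLFunction_rat)
    (hmodD : nonempty_modularParametrizationData)
    (hL20 : Wuthrich2014.lemma20_surjective_threeAdic_of_semistable)
    (hKatoχ : Wuthrich2014.kato_halfEigenCharIdeal_dvd_cyclotomicPrime_of_surjective)
    (hCT : exists_casselsTate_pairing (K := ℚ))
    (hr : W.analyticRank = 0) (hX : ClassX4 W p) (hsurj : Surj W p)
    (hcov : padicValRat p W.j < 0 ∨
      ((∀ n : ℕ, W.HasSurjectiveModNGaloisRep (p ^ n : ℕ)) ∧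
        padicValNat p W.tamagawaProduct =
          padicValNat p ((W.baseChange ℚ_[p]).localTamagawaNumber ℤ_[p]) ∧
        ∃ (N : ℕ) (_ : NeZero N) (D : ModularParametrizationData W N), ¬ (p : ℤ) ∣ D.maninConstant))
    {q : ℚ} (hq : shaAn W = (q : ℂ)) {k : ℕ} (hv : padicValRat p q ≤ 2 * k)
    (hdvd : p ^ (2 * k - 1) ∣ W.shaOrder) : BSDp W p :=
  X4RankZero.bsdp_of_facts_of_lower W p hKatoS hDel hGZK hmod hmodD hL20 hKatoχ hr hX hsurj hcov
    (missingLowerBoundAt_of_casselsTate_of_pow_dvd W p hCT (hGZK W (by rw [hr]; norm_num)).2 hq hv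
      hdvd)

/-! ### §2 The native certificate line `Sel^(p)(E/ℚ) ≠ 0` on the `ord_p #Ш_an ≤ 2` rows -/

/-- **The LOWER residue on the `#Ш_an = p²`-rows closes by the native `p`-descent line
`Sel^(p)(E/ℚ) ≠ 0`.** Covered locus of X4 ∧ `r_an = 0` ∧ surj(p), `#Ш_an = q` with `ord_p q ≤ 2`,
and `Sel^(p)(E/ℚ) ≠ 0` ⟹ `BSD(E,p)`: rank `0` (GZK) and `E(ℚ)[p] = 0` (`E[p]` irreducible,
`Supersingular.not_dvd_torsionOrder_of_irr`) turn the Selmer class into `p ∣ #Ш`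
(`Supersingular.missingLowerBoundAt_of_casselsTate_of_selmerGroup_ne_bot`, class-free), Cassels–Tate
into `p² ∣ #Ш`, and the chain of record concludes. This is the census's LOWER line (84 of the 85 ‖ 25
window rows: all but `19215t1` @ `3`, which has `#Ш_an = 3⁴` and goes through §1 with `k = 2`).
[cite: Kato2004Asterisque, Thm. 14.5 (3) (p. 236)]
[cite: Delbourgo1998, Prop. 4 (p. 144)] [cite: SilvermanAEC2009, Thm. X.4.2 and Thm. X.4.14]
[cite: Miller2011LMS, §1 and Def. 1.1] -/
theorem X4RankZero.bsdp_of_facts_of_casselsTate_of_selmerGroup_ne_bot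
    (hKatoS : Kato2004.rankZero_padicValNat_sha_le_sub_localTamagawa_of_additive_potGood_of_imageContainsSL2)
    (hDel : Delbourgo1998.prop4_rankZero_pow_dvd_constantCoeff)
    (hGZK : rank_eq_analyticRank_of_analyticRank_le_one) (hmod : hasEntireLFunction_rat)
    (hmodD : nonempty_modularParametrizationData)
    (hL20 : Wuthrich2014.lemma20_surjective_threeAdic_of_semistable)
    (hKatoχ : Wuthrich2014.kato_halfEigenCharIdeal_dvd_cyclotomicPrime_of_surjective)
    (hCT : exists_casselsTate_pairing (K := ℚ))
    (hr : W.analyticRank = 0) (hX : ClassX4 W p) (hsurj : Surj W p)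
    (hcov : padicValRat p W.j < 0 ∨
      ((∀ n : ℕ, W.HasSurjectiveModNGaloisRep (p ^ n : ℕ)) ∧
        padicValNat p W.tamagawaProduct =
          padicValNat p ((W.baseChange ℚ_[p]).localTamagawaNumber ℤ_[p]) ∧
        ∃ (N : ℕ) (_ : NeZero N) (D : ModularParametrizationData W N), ¬ (p : ℤ) ∣ D.maninConstant))
    {q : ℚ} (hq : shaAn W = (q : ℂ)) (hv : padicValRat p q ≤ 2)
    (hSel : W.selmerGroup (p : ℤ) ≠ ⊥) : BSDp W p :=
  X4RankZero.bsdp_of_facts_of_lower W p hKatoS hDel hGZK hmod hmodD hL20 hKatoχ hr hX hsurj hcov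
    (Supersingular.missingLowerBoundAt_of_casselsTate_of_selmerGroup_ne_bot W p hCT hGZK hr
      (Supersingular.not_dvd_torsionOrder_of_irr W p hX.2.2) hq hv hSel)

/-! ### §3 Census shapes: `p ≥ 5`; `p = 3` fed by kernel certificates; `p = 3` potentially multiplicative -/

/-- **`p ≥ 5` form**: X4 ∧ `r_an = 0` ∧ surj(p) ∧ [`ord_p j < 0` ∨ (`p ∤ ∏ c_ℓ` ∧ Manin datum)] ∧
`ord_p #Ш_an ≤ 2` ∧ `Sel^(p)(E/ℚ) ≠ 0` ⟹ `BSD(E,p)` (tower by Serre, local term by Kodaira–Néron: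
`X4RankZero.missingUpperBoundAt_of_facts_of_five_le`). Census: the 11 window LOWER rows at `p = 5`
(`#Ш_an = 25`). [cite: Kato2004Asterisque, Thm. 14.5 (3) (p. 236)] [cite: Serre1972, IV §3.4]
[cite: SilvermanAEC2009, Thm. X.4.14] [cite: Miller2011LMS, §1 and Def. 1.1] -/
theorem X4RankZero.bsdp_of_facts_of_casselsTate_of_selmerGroup_ne_bot_of_five_le
    (hKatoS : Kato2004.rankZero_padicValNat_sha_le_sub_localTamagawa_of_additive_potGood_of_imageContainsSL2)
    (hDel : Delbourgo1998.prop4_rankZero_pow_dvd_constantCoeff)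
    (hGZK : rank_eq_analyticRank_of_analyticRank_le_one) (hmod : hasEntireLFunction_rat)
    (hmodD : nonempty_modularParametrizationData)
    (hL20 : Wuthrich2014.lemma20_surjective_threeAdic_of_semistable)
    (hKatoχ : Wuthrich2014.kato_halfEigenCharIdeal_dvd_cyclotomicPrime_of_surjective)
    (hCT : exists_casselsTate_pairing (K := ℚ))
    (hp5 : 5 ≤ p) (hr : W.analyticRank = 0) (hX : ClassX4 W p) (hsurj : Surj W p)
    (hcov : padicValRat p W.j < 0 ∨
      (¬ p ∣ W.tamagawaProduct ∧
        ∃ (N : ℕ) (_ : NeZero N) (D : ModularParametrizationData W N), ¬ (p : ℤ) ∣ D.maninConstant))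
    {q : ℚ} (hq : shaAn W = (q : ℂ)) (hv : padicValRat p q ≤ 2)
    (hSel : W.selmerGroup (p : ℤ) ≠ ⊥) : BSDp W p :=
  X4RankZero.bsdp_of_facts_of_casselsTate_of_selmerGroup_ne_bot W p hKatoS hDel hGZK hmod hmodD hL20
    hKatoχ hCT hr hX hsurj
    (hcov.imp_right fun ⟨htam, hD⟩ ↦ ⟨serre_hasSurjectiveModNGaloisRep_pow_holds W p hp5 hsurj,
      (padicValNat_tamagawaProduct_eq_local_iff_not_dvd_of_addv W p hX.2.1 hp5).mpr htam, hD⟩)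
    hq hv hSel

/-- **`p = 3`, potentially good, fed by kernel certificates** (gen 15 shape of
`Additive/X4ThreeResCertKernel.lean`): `Addv W 3`, surj(3), the tower `∀ n, ρ̄_{E,3^n}` onto (a
kernel record), `r_an = 0`, `#Ш_an = q` with `ord₃ q ≤ 2`, `3 ∤ ∏ c_ℓ`, an optimal datum at level
`N ≤ 130000` (Agashe–Ribet–Stein Thm. 2.6, `h26`), Cassels–Tate (`hCT`) and the `3`-descent line
`Sel^(3)(E/ℚ) ≠ 0` ⟹ `BSD(E,3)`. Census: the potentially good LOWER rows at `3` (`#Ш_an = 9`).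
[cite: Kato2004Asterisque, Thm. 14.5 (3) (p. 236) and (12.5.2) (p. 222)]
[cite: AgasheRibetStein2006, Thm. 2.6 (p. 619)] [cite: SilvermanAEC2009, Thm. X.4.14]
[cite: Miller2011LMS, §1 and Def. 1.1] -/
theorem X4RankZero.bsdp_three_of_towerSurj_of_optimal_of_selmerGroup_ne_bot
    (hKatoS : Kato2004.rankZero_padicValNat_sha_le_sub_localTamagawa_of_additive_potGood_of_imageContainsSL2)
    (hDel : Delbourgo1998.prop4_rankZero_pow_dvd_constantCoeff)
    (hGZK : rank_eq_analyticRank_of_analyticRank_le_one) (hmod : hasEntireLFunction_rat)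
    (hmodD : nonempty_modularParametrizationData)
    (hL20 : Wuthrich2014.lemma20_surjective_threeAdic_of_semistable)
    (hKatoχ : Wuthrich2014.kato_halfEigenCharIdeal_dvd_cyclotomicPrime_of_surjective)
    (h26 : cremona_abs_maninConstant_eq_one_of_level_le)
    (hCT : exists_casselsTate_pairing (K := ℚ))
    (hadd : haveI : Fact (Nat.Prime 3) := ⟨Nat.prime_three⟩; Addv W 3)
    (hsurj : W.HasSurjectiveModNGaloisRep 3)
    (htower : ∀ n : ℕ, W.HasSurjectiveModNGaloisRep (3 ^ n : ℕ))
    (hr : W.analyticRank = 0) {q : ℚ} (hq : shaAn W = (q : ℂ)) (hv : padicValRat 3 q ≤ 2)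
    (htam : ¬ 3 ∣ W.tamagawaProduct)
    {N : ℕ} [NeZero N] (hN : N ≤ 130000)
    (hopt : ∃ D : ModularParametrizationData W N,
      ∀ z ∈ D.L.lattice, ∃ w ∈ periodLattice D.f, z = D.c * w)
    (hSel : W.selmerGroup ((3 : ℕ) : ℤ) ≠ ⊥) :
    haveI : Fact (Nat.Prime 3) := ⟨Nat.prime_three⟩
    BSDp W 3 := by
  haveI : Fact (Nat.Prime 3) := ⟨Nat.prime_three⟩
  have hX : ClassX4 W 3 :=
    ⟨by norm_num, hadd, hasIrreducibleModPGaloisRep_of_hasSurjectiveModNGaloisRep W 3 hsurj⟩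
  exact X4RankZero.bsdp_of_facts_of_casselsTate_of_selmerGroup_ne_bot W 3 hKatoS hDel hGZK hmod hmodD
    hL20 hKatoχ hCT hr hX hsurj (Or.inr ⟨htower, padicValNat_tamagawaProduct_eq_local_of_not_dvd W 3 htam,
      exists_maninDatum_of_optimal h26 W hN hopt⟩) hq hv hSel

/-- **`p = 3`, potentially multiplicative (`ord₃ j < 0`)**: X4 ∧ `r_an = 0` ∧ surj(3) ∧ `ord₃ j < 0`
∧ `ord₃ #Ш_an ≤ 2` ∧ Cassels–Tate ∧ `Sel^(3)(E/ℚ) ≠ 0` ⟹ `BSD(E,3)` — NO tower, Tamagawa or Manin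
binder (the (M) branch of the chain is additive-p1's `ω`-branch route). Census: the (M) LOWER rows at
`3` (`#Ш_an = 9`). [cite: Delbourgo1998, Prop. 4 (p. 144)] [cite: Wuthrich2014, Lemma 20 (p. 399)]
[cite: SilvermanAEC2009, Thm. X.4.14] [cite: Miller2011LMS, §1 and Def. 1.1] -/
theorem X4RankZero.bsdp_three_potMult_of_selmerGroup_ne_bot
    (hKatoS : Kato2004.rankZero_padicValNat_sha_le_sub_localTamagawa_of_additive_potGood_of_imageContainsSL2)
    (hDel : Delbourgo1998.prop4_rankZero_pow_dvd_constantCoeff)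
    (hGZK : rank_eq_analyticRank_of_analyticRank_le_one) (hmod : hasEntireLFunction_rat)
    (hmodD : nonempty_modularParametrizationData)
    (hL20 : Wuthrich2014.lemma20_surjective_threeAdic_of_semistable)
    (hKatoχ : Wuthrich2014.kato_halfEigenCharIdeal_dvd_cyclotomicPrime_of_surjective)
    (hCT : exists_casselsTate_pairing (K := ℚ))
    (hr : W.analyticRank = 0) (hX : haveI : Fact (Nat.Prime 3) := ⟨Nat.prime_three⟩; ClassX4 W 3)
    (hsurj : W.HasSurjectiveModNGaloisRep 3) (hj : padicValRat 3 W.j < 0)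
    {q : ℚ} (hq : shaAn W = (q : ℂ)) (hv : padicValRat 3 q ≤ 2)
    (hSel : W.selmerGroup ((3 : ℕ) : ℤ) ≠ ⊥) :
    haveI : Fact (Nat.Prime 3) := ⟨Nat.prime_three⟩
    BSDp W 3 :=
  haveI : Fact (Nat.Prime 3) := ⟨Nat.prime_three⟩
  X4RankZero.bsdp_of_facts_of_casselsTate_of_selmerGroup_ne_bot W 3 hKatoS hDel hGZK hmod hmodD hL20
    hKatoχ hCT hr hX hsurj (Or.inl hj) hq hv hSel

end Summit.BirchSwinnertonDyer.Rank1Residual.Additive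

end
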